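import Mathlib
import Summits.AtomisticToContinuum.BoseEinsteinCondensation.Theorems.BECCellInformationCoarseChainRule
import Literature.MathematicalPhysics.QuantumManyBody.BoseGasProductState
import Summits.AtomisticToContinuum.BoseEinsteinCondensation.Theorems.BECCutLineWeakDisorderGroundStateRigidityEssBounded

/-!
# Crux `OneBodyEntropyBound` (stmt-AtomisticToContinuum-13440), line `registered`: helpers for the lead's stub
# `stub_coarsePosCore` — cell-occupation combinatorics and the pigeonhole bound on the interaction

Support file (`--supports stmt-AtomisticToContinuum-13440`). For a configuration `X ∈ (ℝ³)^N` and a set `Q ⊂ ℝ³`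
write `a_i = 1_Q(X i)`, `N_Q(X) = Σ_i a_i` (number of particles in `Q`) and `O_Q(X) = Σ_i Σ_{j ≠ i} a_i a_j`
(ordered pairs of particles in `Q`). Then `N_Q² = N_Q + O_Q` pointwise, and for the half-open cells `Q_k` of side
`s` with `3 s² ≤ r₀²` and a potential `v ≥ c₁` on `(0, r₀]`: `c₁ · Σ_k O_{Q_k}(X) ≤ 2 · interaction v X` whenever
the particles of `X` are pairwise distinct (a co-null condition, `JelliumBoseGas.ae_injective`). Elementary; `[folklore]` throughout. Second part (namespace `Partial`): null sets of radii are invisible to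
`energy`/`groundStateEnergy` (`GroundStateRigidity.energy_congr_offNull`), so the coarse and the crux conclusions for a
fixed `v` transfer between a.e.-equal potentials; a.e.-positive core ↦ positive core, a.e.-zero ↦ zero on `(0,∞)`
(glue of the assembly's a.e. case split; worker w-nocore + lead).
-/

noncomputable section

namespace Summit.AtomisticToContinuum.BoseEinsteinCondensation.Cruxes.OneBodyEntropyBound.Birth

open MeasureTheory Set Filter
open scoped ENNReal
open Literature.MathematicalPhysics.QuantumManyBody.BoseGas
open Summit.AtomisticToContinuum.BoseEinsteinCondensation.Theorems

namespace PosCore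

variable {N : ℕ}

/-! ### Occupation numbers of a set -/




/-- Occupation indicators are nonnegative. [folklore] -/
theorem occ_nonneg (Q : Set Space) (X : Config N) (i : Fin N) : 0 ≤ Q.indicator (fun _ => (1 : ℝ)) (X i) :=
  Set.indicator_nonneg (fun _ _ => zero_le_one) _

/-- Occupation indicators are at most one. [folklore] -/
theorem occ_le_one (Q : Set Space) (X : Config N) (i : Fin N) : Q.indicator (fun _ => (1 : ℝ)) (X i) ≤ 1 :=
  Set.indicator_le_self' (fun _ _ => zero_le_one) _

/-- The indicator is `1` on the set. [folklore] -/
theorem occ_of_mem {Q : Set Space} {X : Config N} {i : Fin N} (h : X i ∈ Q) : Q.indicator (fun _ => (1 : ℝ)) (X i) = 1 :=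
  Set.indicator_of_mem h _

/-- The indicator is `0` off the set. [folklore] -/
theorem occ_of_not_mem {Q : Set Space} {X : Config N} {i : Fin N} (h : X i ∉ Q) : Q.indicator (fun _ => (1 : ℝ)) (X i) = 0 :=
  Set.indicator_of_notMem h _

/-- `a_i² = a_i`. [folklore] -/
theorem occ_mul_self (Q : Set Space) (X : Config N) (i : Fin N) : Q.indicator (fun _ => (1 : ℝ)) (X i) * Q.indicator (fun _ => (1 : ℝ)) (X i) = Q.indicator (fun _ => (1 : ℝ)) (X i) := by
  by_cases h : X i ∈ Q
  · rw [occ_of_mem h, mul_one]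
  · rw [occ_of_not_mem h, mul_zero]

/-- Particle numbers are nonnegative. [folklore] -/
theorem num_nonneg (Q : Set Space) (X : Config N) : 0 ≤ (∑ i, Q.indicator (fun _ => (1 : ℝ)) (X i)) :=
  Finset.sum_nonneg fun i _ => occ_nonneg Q X i

/-- Pair counts are nonnegative. [folklore] -/
theorem opairs_nonneg (Q : Set Space) (X : Config N) : 0 ≤ (∑ i, ∑ j ∈ Finset.univ.filter (· ≠ i), Q.indicator (fun _ => (1 : ℝ)) (X i) * Q.indicator (fun _ => (1 : ℝ)) (X j)) :=
  Finset.sum_nonneg fun i _ => Finset.sum_nonneg fun j _ => mul_nonneg (occ_nonneg Q X i) (occ_nonneg Q X j)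

/-- **`N_Q² = N_Q + O_Q`.** [folklore] -/
theorem num_sq (Q : Set Space) (X : Config N) : (∑ i, Q.indicator (fun _ => (1 : ℝ)) (X i)) ^ 2 = (∑ i, Q.indicator (fun _ => (1 : ℝ)) (X i)) + (∑ i, ∑ j ∈ Finset.univ.filter (· ≠ i), Q.indicator (fun _ => (1 : ℝ)) (X i) * Q.indicator (fun _ => (1 : ℝ)) (X j)) := by
  rw [sq, Finset.sum_mul_sum, ← Finset.sum_add_distrib]
  refine Finset.sum_congr rfl fun i _ => ?_
  rw [Finset.filter_ne', ← Finset.add_sum_erase Finset.univ (fun j => Q.indicator (fun _ => (1 : ℝ)) (X i) * Q.indicator (fun _ => (1 : ℝ)) (X j))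
    (Finset.mem_univ i), occ_mul_self]

/-! ### The cells -/


/-- A point lies in at most one cell. [folklore] -/
theorem eq_of_mem_cell {s : ℝ} (hs : 0 < s) {M : ℕ} {k k' : Fin 3 → Fin M} {y : Space}
    (hy : y ∈ {y : Space | ∀ j, y j ∈ Set.Ico (((k j : ℕ) : ℝ) * s) ((((k j : ℕ) : ℝ) + 1) * s)}) (hy' : y ∈ {y : Space | ∀ j, y j ∈ Set.Ico (((k' j : ℕ) : ℝ) * s) ((((k' j : ℕ) : ℝ) + 1) * s)}) : k = k' := by
  by_contra hne
  exact Set.disjoint_left.1 (CoarseChainRule.pairwise_disjoint_cell hs M hne) hy hy'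

/-- Two points of a common cell of side `s` are within distance `r₀` once `3 s² ≤ r₀²`. [folklore] -/
theorem dist_le_of_mem_cell {s r₀ : ℝ} (hr₀ : 0 ≤ r₀) (hsr : 3 * s ^ 2 ≤ r₀ ^ 2) {M : ℕ}
    {k : Fin 3 → Fin M} {x y : Space} (hx : x ∈ {y : Space | ∀ j, y j ∈ Set.Ico (((k j : ℕ) : ℝ) * s) ((((k j : ℕ) : ℝ) + 1) * s)}) (hy : y ∈ {y : Space | ∀ j, y j ∈ Set.Ico (((k j : ℕ) : ℝ) * s) ((((k j : ℕ) : ℝ) + 1) * s)}) : dist x y ≤ r₀ := by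
  have hcoord : ∀ j, dist (x j) (y j) ≤ s := by
    intro j
    have h1 := hx j
    have h2 := hy j
    rw [Real.dist_eq]
    exact abs_le.2 ⟨by linarith [h1.1, h2.2], by linarith [h1.2, h2.1]⟩
  have hd : dist x y ^ 2 ≤ r₀ ^ 2 := by
    rw [EuclideanSpace.dist_eq, Real.sq_sqrt (Finset.sum_nonneg fun j _ => sq_nonneg _)]
    calc ∑ j, dist (x j) (y j) ^ 2 ≤ ∑ _j : Fin 3, s ^ 2 :=
          Finset.sum_le_sum fun j _ => pow_le_pow_left₀ dist_nonneg (hcoord j) 2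
      _ = 3 * s ^ 2 := by simp
      _ ≤ r₀ ^ 2 := hsr
  exact (pow_le_pow_iff_left₀ dist_nonneg hr₀ two_ne_zero).1 hd

/-! ### The pigeonhole bound on the interaction -/

/-- **One pair.** If `v ≥ c₁` on `(0, r₀]` and the cells have `3 s² ≤ r₀²`, then for distinct points `X i ≠ X j`:
`c₁ · Σ_k 1_{Q_k}(X i) 1_{Q_k}(X j) ≤ v(|X i − X j|)` (the sum has at most one nonzero term, and then both points
share a cell). [folklore] -/
theorem pair_bound {v : ℝ → ℝ≥0∞} {c₁ : ℝ≥0∞} {r₀ s : ℝ} (hr₀ : 0 ≤ r₀) (hs : 0 < s)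
    (hsr : 3 * s ^ 2 ≤ r₀ ^ 2) (hv : ∀ r : ℝ, 0 < r → r ≤ r₀ → c₁ ≤ v r) {M : ℕ} (X : Config N)
    {i j : Fin N} (hij : X i ≠ X j) :
    c₁ * ENNReal.ofReal (∑ k : Fin 3 → Fin M, {y : Space | ∀ j, y j ∈ Set.Ico (((k j : ℕ) : ℝ) * s) ((((k j : ℕ) : ℝ) + 1) * s)}.indicator (fun _ => (1 : ℝ)) (X i) * {y : Space | ∀ j, y j ∈ Set.Ico (((k j : ℕ) : ℝ) * s) ((((k j : ℕ) : ℝ) + 1) * s)}.indicator (fun _ => (1 : ℝ)) (X j)) ≤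
      v (dist (X i) (X j)) := by
  by_cases h : ∃ k : Fin 3 → Fin M, X i ∈ {y : Space | ∀ j, y j ∈ Set.Ico (((k j : ℕ) : ℝ) * s) ((((k j : ℕ) : ℝ) + 1) * s)} ∧ X j ∈ {y : Space | ∀ j, y j ∈ Set.Ico (((k j : ℕ) : ℝ) * s) ((((k j : ℕ) : ℝ) + 1) * s)}
  · obtain ⟨k₀, hi, hj⟩ := h
    have hsum : ∑ k : Fin 3 → Fin M, {y : Space | ∀ j, y j ∈ Set.Ico (((k j : ℕ) : ℝ) * s) ((((k j : ℕ) : ℝ) + 1) * s)}.indicator (fun _ => (1 : ℝ)) (X i) * {y : Space | ∀ j, y j ∈ Set.Ico (((k j : ℕ) : ℝ) * s) ((((k j : ℕ) : ℝ) + 1) * s)}.indicator (fun _ => (1 : ℝ)) (X j) = 1 := by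
      rw [Finset.sum_eq_single k₀]
      · rw [occ_of_mem hi, occ_of_mem hj, mul_one]
      · intro k _ hk
        rw [occ_of_not_mem fun h' => hk (eq_of_mem_cell hs h' hi), zero_mul]
      · intro hk; exact absurd (Finset.mem_univ k₀) hk
    rw [hsum, ENNReal.ofReal_one, mul_one]
    exact hv _ (dist_pos.2 hij) (dist_le_of_mem_cell hr₀ hsr hi hj)
  · have hsum : ∑ k : Fin 3 → Fin M, {y : Space | ∀ j, y j ∈ Set.Ico (((k j : ℕ) : ℝ) * s) ((((k j : ℕ) : ℝ) + 1) * s)}.indicator (fun _ => (1 : ℝ)) (X i) * {y : Space | ∀ j, y j ∈ Set.Ico (((k j : ℕ) : ℝ) * s) ((((k j : ℕ) : ℝ) + 1) * s)}.indicator (fun _ => (1 : ℝ)) (X j) = 0 := by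
      refine Finset.sum_eq_zero fun k _ => ?_
      by_cases hi : X i ∈ {y : Space | ∀ j, y j ∈ Set.Ico (((k j : ℕ) : ℝ) * s) ((((k j : ℕ) : ℝ) + 1) * s)}
      · rw [occ_of_not_mem fun hj => h ⟨k, hi, hj⟩, mul_zero]
      · rw [occ_of_not_mem hi, zero_mul]
    rw [hsum, ENNReal.ofReal_zero, mul_zero]
    exact bot_le

/-- **All pairs.** Under the same hypotheses, for a configuration with pairwise distinct particles:
`c₁ · Σ_k O_{Q_k}(X) ≤ 2 · interaction v X`. [folklore] -/
theorem sum_opairs_bound {v : ℝ → ℝ≥0∞} {c₁ : ℝ≥0∞} {r₀ s : ℝ} (hr₀ : 0 ≤ r₀) (hs : 0 < s)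
    (hsr : 3 * s ^ 2 ≤ r₀ ^ 2) (hv : ∀ r : ℝ, 0 < r → r ≤ r₀ → c₁ ≤ v r) {M : ℕ} (X : Config N)
    (hX : ∀ i j : Fin N, i ≠ j → X i ≠ X j) :
    c₁ * ENNReal.ofReal (∑ k : Fin 3 → Fin M, (∑ i, ∑ j ∈ Finset.univ.filter (· ≠ i), {y : Space | ∀ j, y j ∈ Set.Ico (((k j : ℕ) : ℝ) * s) ((((k j : ℕ) : ℝ) + 1) * s)}.indicator (fun _ => (1 : ℝ)) (X i) * {y : Space | ∀ j, y j ∈ Set.Ico (((k j : ℕ) : ℝ) * s) ((((k j : ℕ) : ℝ) + 1) * s)}.indicator (fun _ => (1 : ℝ)) (X j))) ≤ 2 * interaction v X := by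
  rw [Finset.sum_comm, two_mul_interaction]
  rw [ENNReal.ofReal_sum_of_nonneg fun i _ => Finset.sum_nonneg fun k _ => Finset.sum_nonneg
    fun j _ => mul_nonneg (occ_nonneg _ X i) (occ_nonneg _ X j), Finset.mul_sum]
  refine Finset.sum_le_sum fun i _ => ?_
  rw [Finset.sum_comm, ENNReal.ofReal_sum_of_nonneg fun j _ => Finset.sum_nonneg fun k _ =>
    mul_nonneg (occ_nonneg _ X i) (occ_nonneg _ X j), Finset.mul_sum]
  refine Finset.sum_le_sum fun j hj => ?_
  exact pair_bound hr₀ hs hsr hv X (hX i j (Ne.symm (Finset.mem_filter.1 hj).2))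

/-- Each particle lies in at most one cell: `Σ_k N_{Q_k}(X) ≤ N`. [folklore] -/
theorem sum_num_le {s : ℝ} (hs : 0 < s) {M : ℕ} (X : Config N) :
    ∑ k : Fin 3 → Fin M, (∑ i, {y : Space | ∀ j, y j ∈ Set.Ico (((k j : ℕ) : ℝ) * s) ((((k j : ℕ) : ℝ) + 1) * s)}.indicator (fun _ => (1 : ℝ)) (X i)) ≤ N := by
  rw [Finset.sum_comm]
  have h1 : ∀ i : Fin N, ∑ k : Fin 3 → Fin M, {y : Space | ∀ j, y j ∈ Set.Ico (((k j : ℕ) : ℝ) * s) ((((k j : ℕ) : ℝ) + 1) * s)}.indicator (fun _ => (1 : ℝ)) (X i) ≤ 1 := by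
    intro i
    by_cases h : ∃ k : Fin 3 → Fin M, X i ∈ {y : Space | ∀ j, y j ∈ Set.Ico (((k j : ℕ) : ℝ) * s) ((((k j : ℕ) : ℝ) + 1) * s)}
    · obtain ⟨k₀, hk₀⟩ := h
      rw [Finset.sum_eq_single k₀]
      · exact occ_le_one _ X i
      · intro k _ hk
        exact occ_of_not_mem fun h' => hk (eq_of_mem_cell hs h' hk₀)
      · intro hk; exact absurd (Finset.mem_univ k₀) hk
    · rw [Finset.sum_eq_zero fun k _ => occ_of_not_mem fun hk => h ⟨k, hk⟩]
      exact zero_le_one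
  calc ∑ i : Fin N, ∑ k : Fin 3 → Fin M, {y : Space | ∀ j, y j ∈ Set.Ico (((k j : ℕ) : ℝ) * s) ((((k j : ℕ) : ℝ) + 1) * s)}.indicator (fun _ => (1 : ℝ)) (X i) ≤ ∑ _i : Fin N, (1 : ℝ) :=
        Finset.sum_le_sum fun i _ => h1 i
    _ = N := by simp


/-- **Registered helper stub `stub_posCorePairBound`** (= `sum_opairs_bound`, closed form): the pigeonhole bound on the
interaction for configurations with pairwise distinct particles. [folklore] -/
theorem stub_posCorePairBound :
    ∀ (N : ℕ) (v : ℝ → ENNReal) (c₁ : ENNReal) (r₀ s : ℝ), 0 ≤ r₀ → 0 < s → 3 * s ^ 2 ≤ r₀ ^ 2 →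
      (∀ r : ℝ, 0 < r → r ≤ r₀ → c₁ ≤ v r) → ∀ (M : ℕ) (X : Literature.MathematicalPhysics.QuantumManyBody.BoseGas.Config N),
      (∀ i j : Fin N, i ≠ j → X i ≠ X j) →
      c₁ * ENNReal.ofReal (∑ k : Fin 3 → Fin M, ∑ i : Fin N, ∑ j ∈ Finset.univ.filter (· ≠ i),
      {y : EuclideanSpace ℝ (Fin 3) | ∀ j, y j ∈ Set.Ico (((k j : ℕ) : ℝ) * s) ((((k j : ℕ) : ℝ) + 1) * s)}.indicator
      (fun _ => (1 : ℝ)) (X i) *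
      {y : EuclideanSpace ℝ (Fin 3) | ∀ j, y j ∈ Set.Ico (((k j : ℕ) : ℝ) * s) ((((k j : ℕ) : ℝ) + 1) * s)}.indicator
      (fun _ => (1 : ℝ)) (X j)) ≤ 2 * Literature.MathematicalPhysics.QuantumManyBody.BoseGas.interaction v X :=
  fun _ _ _ _ _ hr₀ hs hsr hv _ X hX => sum_opairs_bound hr₀ hs hsr hv X hX

end PosCore

/-! ## Glue for the a.e. case split of the line's assembly (used by `Lines/birth.lean` and the partial result) -/

namespace Partial

/-! ### Null sets of radii are invisible (the conclusions depend on the a.e. class of `v` only) -/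

/-- The coarse conclusion transfers between potentials agreeing off a Lebesgue-null set of radii (`energy` and
`groundStateEnergy` do: `GroundStateRigidity.energy_congr_offNull`). [folklore] -/
theorem coarse_congr_offNull {v v' : ℝ → ENNReal} {S : Set ℝ} (hS : MeasurableSet S)
    (h0 : MeasureTheory.volume S = 0) (h : ∀ r, r ∉ S → v r = v' r)
    (hv' : ∃ ρ₀ : ℝ, 0
      < ρ₀ ∧ ∀ ρ : ℝ, 0 < ρ → ρ < ρ₀ → ∃ l : ℝ, 0 < l ∧ ∃ C : ℝ, ∀ᶠ n : ℕ in Filter.atTop, ∃ δ :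
      ENNReal, 0 < δ ∧ ∀ Ψ : Literature.MathematicalPhysics.QuantumManyBody.BoseGas.TrialState (n +
      1) (Literature.MathematicalPhysics.QuantumManyBody.BoseGas.sideLength ρ (n + 1)),
      Literature.MathematicalPhysics.QuantumManyBody.BoseGas.energy v' Ψ ≤
      Literature.MathematicalPhysics.QuantumManyBody.BoseGas.groundStateEnergy v' (n + 1)
      (Literature.MathematicalPhysics.QuantumManyBody.BoseGas.sideLength ρ (n + 1)) + δ →
      ENNReal.ofReal (∑ k : Fin 3 → Fin
      ⌈Literature.MathematicalPhysics.QuantumManyBody.BoseGas.sideLength ρ (n + 1) / l⌉₊,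
      ((⌈Literature.MathematicalPhysics.QuantumManyBody.BoseGas.sideLength ρ (n + 1) / l⌉₊ : ℝ) ^
      3)⁻¹ * InformationTheory.klFun
      ((⌈Literature.MathematicalPhysics.QuantumManyBody.BoseGas.sideLength ρ (n + 1) / l⌉₊ : ℝ) ^ 3
      * (∫ x in {y : EuclideanSpace ℝ (Fin 3) | ∀ j, y j ∈ Set.Ico (((k j : ℕ) : ℝ) *
      ((Literature.MathematicalPhysics.QuantumManyBody.BoseGas.sideLength ρ (n + 1)) /
      (⌈Literature.MathematicalPhysics.QuantumManyBody.BoseGas.sideLength ρ (n + 1) / l⌉₊ : ℝ)))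
      ((((k j : ℕ) : ℝ) + 1) * ((Literature.MathematicalPhysics.QuantumManyBody.BoseGas.sideLength
      ρ (n + 1)) / (⌈Literature.MathematicalPhysics.QuantumManyBody.BoseGas.sideLength ρ (n + 1) /
      l⌉₊ : ℝ)))}, ∫ Y' : Literature.MathematicalPhysics.QuantumManyBody.BoseGas.Config n, ‖Ψ.ψ
      (Matrix.vecCons x Y')‖ ^ 2))) ≤ ENNReal.ofReal C) :
    ∃ ρ₀ : ℝ, 0
      < ρ₀ ∧ ∀ ρ : ℝ, 0 < ρ → ρ < ρ₀ → ∃ l : ℝ, 0 < l ∧ ∃ C : ℝ, ∀ᶠ n : ℕ in Filter.atTop, ∃ δ :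
      ENNReal, 0 < δ ∧ ∀ Ψ : Literature.MathematicalPhysics.QuantumManyBody.BoseGas.TrialState (n +
      1) (Literature.MathematicalPhysics.QuantumManyBody.BoseGas.sideLength ρ (n + 1)),
      Literature.MathematicalPhysics.QuantumManyBody.BoseGas.energy v Ψ ≤
      Literature.MathematicalPhysics.QuantumManyBody.BoseGas.groundStateEnergy v (n + 1)
      (Literature.MathematicalPhysics.QuantumManyBody.BoseGas.sideLength ρ (n + 1)) + δ →
      ENNReal.ofReal (∑ k : Fin 3 → Fin
      ⌈Literature.MathematicalPhysics.QuantumManyBody.BoseGas.sideLength ρ (n + 1) / l⌉₊,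
      ((⌈Literature.MathematicalPhysics.QuantumManyBody.BoseGas.sideLength ρ (n + 1) / l⌉₊ : ℝ) ^
      3)⁻¹ * InformationTheory.klFun
      ((⌈Literature.MathematicalPhysics.QuantumManyBody.BoseGas.sideLength ρ (n + 1) / l⌉₊ : ℝ) ^ 3
      * (∫ x in {y : EuclideanSpace ℝ (Fin 3) | ∀ j, y j ∈ Set.Ico (((k j : ℕ) : ℝ) *
      ((Literature.MathematicalPhysics.QuantumManyBody.BoseGas.sideLength ρ (n + 1)) /
      (⌈Literature.MathematicalPhysics.QuantumManyBody.BoseGas.sideLength ρ (n + 1) / l⌉₊ : ℝ)))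
      ((((k j : ℕ) : ℝ) + 1) * ((Literature.MathematicalPhysics.QuantumManyBody.BoseGas.sideLength
      ρ (n + 1)) / (⌈Literature.MathematicalPhysics.QuantumManyBody.BoseGas.sideLength ρ (n + 1) /
      l⌉₊ : ℝ)))}, ∫ Y' : Literature.MathematicalPhysics.QuantumManyBody.BoseGas.Config n, ‖Ψ.ψ
      (Matrix.vecCons x Y')‖ ^ 2))) ≤ ENNReal.ofReal C := by
  obtain ⟨ρ₀, hρ₀, h1⟩ := hv'
  refine ⟨ρ₀, hρ₀, fun ρ hρ hρlt => ?_⟩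
  obtain ⟨l, hl, C, hC⟩ := h1 ρ hρ hρlt
  refine ⟨l, hl, C, ?_⟩
  filter_upwards [hC] with n hn
  obtain ⟨δ, hδ, hΨ⟩ := hn
  refine ⟨δ, hδ, fun Ψ hΨE => hΨ Ψ ?_⟩
  rwa [← GroundStateRigidity.energy_congr_offNull hS h0 h Ψ,
    ← GroundStateRigidity.groundStateEnergy_congr_offNull hS h0 h]

/-- The crux conclusion transfers between potentials agreeing off a Lebesgue-null set of radii. [folklore] -/
theorem crux_congr_offNull {v v' : ℝ → ENNReal} {S : Set ℝ} (hS : MeasurableSet S)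
    (h0 : MeasureTheory.volume S = 0) (h : ∀ r, r ∉ S → v r = v' r)
    (hv' : ∃ ρ₀ : ℝ, 0 < ρ₀ ∧ ∀ ρ : ℝ, 0 < ρ → ρ < ρ₀ → ∃ C : ℝ,
      ∀ᶠ n : ℕ in Filter.atTop, ∃ δ : ENNReal, 0 < δ ∧ ∀ Ψ :
      Literature.MathematicalPhysics.QuantumManyBody.BoseGas.TrialState (n + 1)
      (Literature.MathematicalPhysics.QuantumManyBody.BoseGas.sideLength ρ (n + 1)),
      Literature.MathematicalPhysics.QuantumManyBody.BoseGas.energy v' Ψ ≤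
      Literature.MathematicalPhysics.QuantumManyBody.BoseGas.groundStateEnergy v' (n + 1)
      (Literature.MathematicalPhysics.QuantumManyBody.BoseGas.sideLength ρ (n + 1)) + δ → ∫⁻ x in
      Literature.MathematicalPhysics.QuantumManyBody.BoseGas.box
      (Literature.MathematicalPhysics.QuantumManyBody.BoseGas.sideLength ρ (n + 1)), ENNReal.ofReal
      ((Literature.MathematicalPhysics.QuantumManyBody.BoseGas.sideLength ρ (n + 1) ^ 3)⁻¹ *
      InformationTheory.klFun (Literature.MathematicalPhysics.QuantumManyBody.BoseGas.sideLength ρ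
      (n + 1) ^ 3 * (∫ Y' : Literature.MathematicalPhysics.QuantumManyBody.BoseGas.Config n, ‖Ψ.ψ
      (Matrix.vecCons x Y')‖ ^ 2))) ≤ ENNReal.ofReal C) :
    ∃ ρ₀ : ℝ, 0 < ρ₀ ∧ ∀ ρ : ℝ, 0 < ρ → ρ < ρ₀ → ∃ C : ℝ,
      ∀ᶠ n : ℕ in Filter.atTop, ∃ δ : ENNReal, 0 < δ ∧ ∀ Ψ :
      Literature.MathematicalPhysics.QuantumManyBody.BoseGas.TrialState (n + 1)
      (Literature.MathematicalPhysics.QuantumManyBody.BoseGas.sideLength ρ (n + 1)),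
      Literature.MathematicalPhysics.QuantumManyBody.BoseGas.energy v Ψ ≤
      Literature.MathematicalPhysics.QuantumManyBody.BoseGas.groundStateEnergy v (n + 1)
      (Literature.MathematicalPhysics.QuantumManyBody.BoseGas.sideLength ρ (n + 1)) + δ → ∫⁻ x in
      Literature.MathematicalPhysics.QuantumManyBody.BoseGas.box
      (Literature.MathematicalPhysics.QuantumManyBody.BoseGas.sideLength ρ (n + 1)), ENNReal.ofReal
      ((Literature.MathematicalPhysics.QuantumManyBody.BoseGas.sideLength ρ (n + 1) ^ 3)⁻¹ *
      InformationTheory.klFun (Literature.MathematicalPhysics.QuantumManyBody.BoseGas.sideLength ρ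
      (n + 1) ^ 3 * (∫ Y' : Literature.MathematicalPhysics.QuantumManyBody.BoseGas.Config n, ‖Ψ.ψ
      (Matrix.vecCons x Y')‖ ^ 2))) ≤ ENNReal.ofReal C := by
  obtain ⟨ρ₀, hρ₀, h1⟩ := hv'
  refine ⟨ρ₀, hρ₀, fun ρ hρ hρlt => ?_⟩
  obtain ⟨C, hC⟩ := h1 ρ hρ hρlt
  refine ⟨C, ?_⟩
  filter_upwards [hC] with n hn
  obtain ⟨δ, hδ, hΨ⟩ := hn
  refine ⟨δ, hδ, fun Ψ hΨE => hΨ Ψ ?_⟩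
  rwa [← GroundStateRigidity.energy_congr_offNull hS h0 h Ψ,
    ← GroundStateRigidity.groundStateEnergy_congr_offNull hS h0 h]

/-- **a.e.-positive core ↦ positive core.** If `v` is measurable of finite range and `v ≥ c` for a.e. `r ∈ (0, r₀]`,
then `v' := v ⊔ c·1_{(0,r₀]}` is measurable of finite range, `v' ≥ c` on `(0, r₀]`, and `v' = v` off a measurable
null set of radii. (Worker w-nocore, wave 1.) [folklore] -/
theorem exists_posCore_modification {v : ℝ → ENNReal} (hv : IsRepulsiveFiniteRange v) {c : ENNReal} {r₀ : ℝ}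
    (hae : ∀ᵐ r ∂(volume.restrict (Set.Ioc (0 : ℝ) r₀)), c ≤ v r) :
    ∃ v' : ℝ → ENNReal, IsRepulsiveFiniteRange v' ∧ (∀ r : ℝ, 0 < r → r ≤ r₀ → c ≤ v' r) ∧
      ∃ S : Set ℝ, MeasurableSet S ∧ volume S = 0 ∧ ∀ r, r ∉ S → v r = v' r := by
  obtain ⟨hvm, R₀, hR₀⟩ := hv
  refine ⟨fun r => v r ⊔ (Set.Ioc (0 : ℝ) r₀).indicator (fun _ => c) r, ⟨?_, max R₀ r₀, ?_⟩, ?_,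
    Set.Ioc (0 : ℝ) r₀ ∩ {r | ¬ c ≤ v r}, ?_, ?_, ?_⟩
  · exact hvm.sup (measurable_const.indicator measurableSet_Ioc)
  · intro r hr
    have h1 : v r = 0 := hR₀ r ((le_max_left _ _).trans_lt hr)
    have h2 : r ∉ Set.Ioc (0 : ℝ) r₀ := fun hm =>
      (lt_irrefl _) (((le_max_right R₀ r₀).trans_lt hr).trans_le hm.2)
    simp [h1, Set.indicator_of_notMem h2]
  · intro r hr hrr
    have hm : r ∈ Set.Ioc (0 : ℝ) r₀ := ⟨hr, hrr⟩
    simp [Set.indicator_of_mem hm]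
  · exact measurableSet_Ioc.inter (hvm measurableSet_Ici).compl
  · have h1 : (volume.restrict (Set.Ioc (0 : ℝ) r₀)) {r | ¬ c ≤ v r} = 0 := ae_iff.1 hae
    rw [Measure.restrict_apply' measurableSet_Ioc] at h1
    rwa [Set.inter_comm]
  · intro r hr
    by_cases hm : r ∈ Set.Ioc (0 : ℝ) r₀
    · have hc : c ≤ v r := by
        by_contra hc
        exact hr ⟨hm, hc⟩
      simp [Set.indicator_of_mem hm, sup_eq_left.2 hc]
    · simp [Set.indicator_of_notMem hm]

/-- **a.e.-zero ↦ zero on `(0,∞)`.** If `v` is measurable and `v = 0` for a.e. `r > 0`, then `v₀ := 1_{(-∞,0]}·v`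
vanishes on `(0,∞)` and agrees with `v` off a measurable null set of radii. (Worker w-nocore, wave 1.) [folklore] -/
theorem zero_modification {v : ℝ → ENNReal} (hvm : Measurable v)
    (hae : ∀ᵐ r ∂(volume.restrict (Set.Ioi (0 : ℝ))), v r = 0) :
    (∀ r : ℝ, 0 < r → (Set.Iic (0 : ℝ)).indicator v r = 0) ∧
      ∃ S : Set ℝ, MeasurableSet S ∧ volume S = 0 ∧ ∀ r, r ∉ S → v r = (Set.Iic (0 : ℝ)).indicator v r := by
  refine ⟨fun r hr => Set.indicator_of_notMem
      (show r ∉ Set.Iic (0 : ℝ) from fun h => (lt_irrefl (0 : ℝ)) (hr.trans_le (Set.mem_Iic.1 h))) _,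
    Set.Ioi (0 : ℝ) ∩ {r | ¬ v r = 0}, measurableSet_Ioi.inter (hvm (measurableSet_singleton 0)).compl, ?_, ?_⟩
  · have h1 : (volume.restrict (Set.Ioi (0 : ℝ))) {r | ¬ v r = 0} = 0 := ae_iff.1 hae
    rw [Measure.restrict_apply' measurableSet_Ioi] at h1
    rwa [Set.inter_comm]
  · intro r hr
    by_cases hm : r ∈ Set.Ioi (0 : ℝ)
    · have h0 : v r = 0 := by
        by_contra h0
        exact hr ⟨hm, h0⟩
      have hm' : r ∉ Set.Iic (0 : ℝ) := fun h =>
        (lt_irrefl (0 : ℝ)) ((Set.mem_Ioi.1 hm).trans_le (Set.mem_Iic.1 h))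
      rw [h0, Set.indicator_of_notMem hm']
    · have hm' : r ∈ Set.Iic (0 : ℝ) := Set.mem_Iic.2 (le_of_not_gt fun h => hm (Set.mem_Ioi.2 h))
      rw [Set.indicator_of_mem hm']


end Partial


end Summit.AtomisticToContinuum.BoseEinsteinCondensation.Cruxes.OneBodyEntropyBound.Birth

end
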